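import Mathlib
import Summits.NavierStokesRegularity.NavierStokesRegularity.Theorems.ThreadingFluxHorizonTowerFiniteTowerGcdTwoCompetitor
import HarnessLib

/-!
# Crux `PoloidalLiouville` (stmt-NavierStokesRegularity-1222), crux idea «horizon-threading-tower» (ns-idea-15):
# FINITE TOWERS AT ORDER ONE — THM J at the `E3` level (coaxial zonality and zonal functional forms)

Support file (`--supports stmt-NavierStokesRegularity-1222`, helper; cell `ns-wall-extremal`, width hand ns-wall-eng-3 g6; 0 kit).

★★ `finiteTower_zonal_of_gcdTwoCompetitor` / `finiteTower_zonalForm_of_gcdTwoCompetitor`: THM J (`…FiniteTowerGcdTwoCompetitor`,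
polynomial level `finiteTower_exists_axis_of_gcdTwoCompetitor`) transported to the shells `H_l : E3 → ℝ` by the polynomial models
(`finiteTower_exists_polys`) and the zonal-top descent (`finiteTower_detP_lin_eq_zero_of_top`, THM A): a scale-free finite tower of horizon
profiles of smooth homogeneous harmonic shells annihilated by the order-one horizon law off the centre, top pair `D′ = 2(m+2) < D = 2(n+2)`
with `m+2 ⊥ n+2`, `H_D, H_{D′} ≢ 0`, the competitor shell of degree `D′ − 2` and all lower shells free, no shell of degree `D′ − 4` unless that
degree is `≤ 2`, is COAXIALLY ZONAL.

HONEST LABEL: an infinite family of cells of the crux-idea CONJECTURE `HorizonTowerZonality` at ORDER ONE (information-grade);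
`PoloidalLiouville` (1222), `UnthreadedRigidity` (27585) OPEN; W1 movement 0; NS regularity NOT proved.  [folklore]
-/

-- the summit and its single sub-problem share the name (CONVENTIONS §1)
set_option linter.dupNamespace false
-- `simp only` closers over `C`-coefficients are import-order sensitive (simprocs); keep the lists explicit, silence the arg linter
set_option linter.unusedSimpArgs false

noncomputable section

open MvPolynomial
open scoped RealInnerProductSpace
open Literature.Analysis.FluidPDE (cross)

namespace Summit.NavierStokesRegularity.NavierStokesRegularity.Theorems.PoloidalLiouville.HorizonTower

section FiniteTower

variable (K : Finset ℕ) (H : ℕ → E3 → ℝ)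

/-- ★★ **THM J — THE THIRD CONE DIGIT IN GENERAL DEGREE.**  A scale-free finite tower of horizon profiles of smooth homogeneous harmonic shells
(degrees `≥ 1`) annihilated by the order-one horizon law off the centre, whose two largest degrees are `D′ = 2(m+2) < D = 2(n+2)` with
`m + 2`, `n + 2` coprime, with `H_D, H_{D′} ≢ 0`, the competitor shell of degree `D′ − 2` and all lower shells free, and no shell of degree
`D′ − 4` unless that degree is `≤ 2`, is COAXIALLY ZONAL: one axis `a ≠ 0` has `⟪a × y, ∇H_l⟫ ≡ 0` for every shell. [folklore] -/
theorem finiteTower_zonal_of_gcdTwoCompetitor (hK : ∀ l ∈ K, 1 ≤ l) (hH : ∀ l ∈ K, ContDiff ℝ (⊤ : ℕ∞) (H l))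
    (hhom : ∀ l ∈ K, ∀ (c : ℝ) (y : E3), H l (c • y) = c ^ l * H l y)
    (hharm : ∀ l ∈ K, ∀ y, Laplacian.laplacian (H l) y = 0)
    (hL1 : ∀ x : E3, x ≠ 0 → horizonL1 (fun z => ∑ l ∈ K, horizonProfile l (H l) 0 z) 0 x = 0)
    {m n : ℕ} (hmn : m < n) (hcop : (m + 2).Coprime (n + 2)) (hD : 2 * (n + 2) ∈ K) (hD' : 2 * (m + 2) ∈ K)
    (hmax : ∀ l ∈ K, l ≤ 2 * (n + 2)) (hsec : ∀ l ∈ K, l ≠ 2 * (n + 2) → l ≤ 2 * (m + 2))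
    (hgap4 : ∀ l ∈ K, l + 4 = 2 * (m + 2) → l ≤ 2) (hD0 : ∃ y, H (2 * (n + 2)) y ≠ 0) (hD'0 : ∃ y, H (2 * (m + 2)) y ≠ 0) :
    ∃ a : E3, a ≠ 0 ∧ ∀ l ∈ K, ∀ y : E3, ⟪cross a y, gradient (H l) y⟫ = 0 := by
  obtain ⟨P, hP⟩ := finiteTower_exists_polys K H hH hhom hharm
  have hne : ∀ {l}, l ∈ K → (∃ y, H l y ≠ 0) → P l ≠ 0 := by
    intro l hl ⟨y, hy⟩ h
    apply hy
    rw [(hP l hl).2.2 y, h]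
    simp [Zonal.evalE]
  obtain ⟨v, hv, htop⟩ := finiteTower_exists_axis_of_gcdTwoCompetitor K H hK hH hhom hharm hL1 P hP hmn hcop hD hD' hmax hsec hgap4
    (hne hD hD0) (hne hD' hD'0)
  have hna : (WithLp.toLp 2 v : E3) ≠ 0 := by
    intro h
    apply hv
    funext i
    have := congrArg (fun u : E3 => u i) h
    simpa using this
  refine ⟨WithLp.toLp 2 v, hna, fun l hl y => ?_⟩
  have h := finiteTower_detP_lin_eq_zero_of_top K H hK hH hhom hharm hL1 P hP hD hmax (hne hD hD0) hv htop l hl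
  rw [Zonal.detP_lin_eq_zero_iff] at h
  have := h y
  rwa [← show H l = Zonal.evalE (P l) from funext (hP l hl).2.2] at this

/-- THM J with the ZONAL FUNCTIONAL FORMS of the Defs twin as conclusion. [folklore] -/
theorem finiteTower_zonalForm_of_gcdTwoCompetitor (hK : ∀ l ∈ K, 1 ≤ l) (hH : ∀ l ∈ K, ContDiff ℝ (⊤ : ℕ∞) (H l))
    (hhom : ∀ l ∈ K, ∀ (c : ℝ) (y : E3), H l (c • y) = c ^ l * H l y)
    (hharm : ∀ l ∈ K, ∀ y, Laplacian.laplacian (H l) y = 0)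
    (hL1 : ∀ x : E3, x ≠ 0 → horizonL1 (fun z => ∑ l ∈ K, horizonProfile l (H l) 0 z) 0 x = 0)
    {m n : ℕ} (hmn : m < n) (hcop : (m + 2).Coprime (n + 2)) (hD : 2 * (n + 2) ∈ K) (hD' : 2 * (m + 2) ∈ K)
    (hmax : ∀ l ∈ K, l ≤ 2 * (n + 2)) (hsec : ∀ l ∈ K, l ≠ 2 * (n + 2) → l ≤ 2 * (m + 2))
    (hgap4 : ∀ l ∈ K, l + 4 = 2 * (m + 2) → l ≤ 2) (hD0 : ∃ y, H (2 * (n + 2)) y ≠ 0) (hD'0 : ∃ y, H (2 * (m + 2)) y ≠ 0) :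
    ∃ a : E3, a ≠ 0 ∧ ∀ l ∈ K, ∃ g : ℝ → ℝ, ∀ y : E3, y ≠ 0 → H l y = ‖y‖ ^ l * g (⟪a, y⟫ / ‖y‖) := by
  obtain ⟨a, ha, hall⟩ := finiteTower_zonal_of_gcdTwoCompetitor K H hK hH hhom hharm hL1 hmn hcop hD hD' hmax hsec hgap4 hD0 hD'0
  refine ⟨a, ha, fun l hl => ?_⟩
  exact exists_zonalForm_of_inner_cross_gradient_eq_zero (l := l) ha ((hH l hl).differentiable (by simp))
    (fun c y _ => hhom l hl c y) (hall l hl)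

end FiniteTower

end Summit.NavierStokesRegularity.NavierStokesRegularity.Theorems.PoloidalLiouville.HorizonTower

end
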